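import Summits.ResolutionOfSingularities.ResolutionOfSingularities.Theorems.FrobeniusClosingSteerWords07SteeredLeaves

/-!
# Crux `Steer` (stmt-ResolutionOfSingularities-16345), line `switching-dichotomy` — WORDS 12: MEMBER-DATUM words for a
# NON-isolated F-B point tail (res-L0-w41-tri-1 g5 text `L/res-L0-w41-tri-1/v614/MemberDatum.lean` c53f80ab1efd935a,
# res-L0-w41-plan-1 RULING 132a / 137a; D·S3–D·S5 currency for res-type-096's S1a/S1b and res-type-062's slot H1)

Hoisted VERBATIM (bodies byte for byte) from the tri-1 sketch into the `…SwitchingDichotomy.Words` namespace so that the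
typers import the words by name (RULING 137a).  All predicates are INTRINSIC to one stage `i` of a run `(R, P, s)`
(radicand `f_i := s i ^ p ∈ R i`), except the visit / law words which read two stages.  No numeric functions (no `sSup`
junk): orders are carried as EXACT predicates, in the shape of strat-2's (g′0) `OddCleanedPointStepAt`.  OURS; candidates /
vocabulary, not facts; nothing here is a statement of the manuscript [claim: Hironaka2017, status: under-review]; AI review
is weaker than expert review.  `p = 2` in every use; `K : Type` (universe 0, as the Steer vocabulary).

Dictionary (late (M)-tail, p = 2, after D·S0–D·S2): at a POINT-STEP stage the member is FULLY STRIPPED (every regular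
parameter has cleaned order ≤ 1 along it — strips are σ_top-forced first), so an ODD DIVISOR through the centre is a
regular parameter `x` with `f ∈ η² + x·G`, `G ∉ (x)` (clord exactly 1; res-L0-w41-tri-2's `OddDivisorThroughAt` is the
`k = 1` case of `IsOddDivisorAt` below and is equivalent to it at point-step stages).  A-STAGE: no odd divisor, cleaned
order `ν = d` odd.  B-STAGE: exactly one odd divisor `u`, `f = η² + u·G`, cleaned order `ν = d + 1` (the h-free part `G`
is only defined modulo `u·(squares)` — e.g. `η² + x z³ = (η + x)² + x (z³ + x)` — so its own cleaned order is NOT a word;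
the intrinsic quantity is `ν(f)` and the REDUCED order `d_i := ν_i − #odd_i`, D·S3).  Between consecutive point steps
`j < j′` (a VISIT PAIR) only strips along the new exceptional divisor `V(x_j)` occur, the ring is constant
(`R (j+1) = R j′`, 062 S8), and the composite law is `s j′ · x_j ^ m = s j − G` with `G ∈ R j′`, `m = ν_j / 2` (so
`f_{j′} · x_j ^ (2m) = f_j − G ^ 2`, `2m = ν_j − (ν_j % 2)`): `ν_j` odd ⇒ `x_j` is THE odd divisor at `j′`; `ν_j` even ⇒
`x_j` is even at `j′` and an odd divisor `u` at `j` survives as `u / x_j` iff `u / x_j ∈ 𝔪_{j′}` (satellite) — D·S4.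
-/

set_option linter.dupNamespace false

namespace Summit.ResolutionOfSingularities.ResolutionOfSingularities.Theorems.SwitchingDichotomy.Words

section MemberDatum

open IsLocalRing

variable {K : Type} [Field K]

/-- **ν · HasCleanedOrderAt**: the CLEANED ORDER of the member at stage `i` is EXACTLY `ν`
(`max_g ord(f_i − g^p) = ν`; (g′0)'s shape without the parity / point-step clauses). OURS. [folklore] -/
def HasCleanedOrderAt (R : ℕ → Subring K) (s : ℕ → K) (p i ν : ℕ) : Prop :=
  ∃ (_ : IsLocalRing (R i)) (hs : s i ^ p ∈ R i),
    (∃ g : R i, (⟨s i ^ p, hs⟩ : R i) - g ^ p ∈ maximalIdeal (R i) ^ ν) ∧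
    ∀ g : R i, (⟨s i ^ p, hs⟩ : R i) - g ^ p ∉ maximalIdeal (R i) ^ (ν + 1)

/-- **clord · HasClordAlongAt**: the CLEANED ORDER of the member ALONG the element `x ∈ R i` is EXACTLY `k`
(`max_g` of the `x`-adic order of `f_i − g^p`).  `x : K` so that the same element can be followed across stages. OURS. [folklore] -/
def HasClordAlongAt (R : ℕ → Subring K) (s : ℕ → K) (p i : ℕ) (x : K) (k : ℕ) : Prop :=
  ∃ (hx : x ∈ R i) (hs : s i ^ p ∈ R i),
    (∃ g : R i, (⟨s i ^ p, hs⟩ : R i) - g ^ p ∈ Ideal.span {(⟨x, hx⟩ : R i) ^ k}) ∧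
    ∀ g : R i, (⟨s i ^ p, hs⟩ : R i) - g ^ p ∉ Ideal.span {(⟨x, hx⟩ : R i) ^ (k + 1)}

/-- **IsOddDivisorAt**: `x` is (a local equation of) an ODD DIVISOR through the centre at stage `i`: a REGULAR PARAMETER
(`x ∈ 𝔪 ∖ 𝔪²`) along which the cleaned order of the member is ODD.  At point-step stages (fully stripped) the odd
order is `1` and this is tri-2's `OddDivisorThroughAt` witness. OURS. [folklore] -/
def IsOddDivisorAt (R : ℕ → Subring K) (s : ℕ → K) (p i : ℕ) (x : K) : Prop :=
  ∃ (_ : IsLocalRing (R i)) (hx : x ∈ R i),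
    (⟨x, hx⟩ : R i) ∈ maximalIdeal (R i) ∧ (⟨x, hx⟩ : R i) ∉ maximalIdeal (R i) ^ 2 ∧
    ∃ k : ℕ, Odd k ∧ HasClordAlongAt R s p i x k

/-- **#odd = 0 · NoOddDivisorAt** (A-type stage). OURS. [folklore] -/
def NoOddDivisorAt (R : ℕ → Subring K) (s : ℕ → K) (p i : ℕ) : Prop :=
  ∀ x : K, ¬ IsOddDivisorAt R s p i x

/-- **#odd ≤ 1 · AtMostOneOddDivisorAt**: any two odd divisors through the centre generate the same ideal
(D·S1 / NoTwoOdd: two distinct ones make `V(x, x′)` a permissible surface, excluded late). OURS. [folklore] -/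
def AtMostOneOddDivisorAt (R : ℕ → Subring K) (s : ℕ → K) (p i : ℕ) : Prop :=
  ∀ x x' : K, IsOddDivisorAt R s p i x → IsOddDivisorAt R s p i x' →
    ∃ (hx : x ∈ R i) (hx' : x' ∈ R i), Ideal.span {(⟨x, hx⟩ : R i)} = Ideal.span {(⟨x', hx'⟩ : R i)}

/-- **h · OddExcPartAt**: `h ∈ K` is THE SQUARE-FREE ODD EXCEPTIONAL PART of the member at stage `i` in the late regime
(`#odd ≤ 1`): either there is no odd divisor and `h = 1`, or `h` is an odd divisor and every odd divisor is associate to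
it.  (D·S5 splitting, a LEMMA not a word: then `f_i = η^p + h·G` with `G ∉ (h)` when `h ≠ 1`.) OURS. [folklore] -/
def OddExcPartAt (R : ℕ → Subring K) (s : ℕ → K) (p i : ℕ) (h : K) : Prop :=
  (NoOddDivisorAt R s p i ∧ h = 1) ∨
  (IsOddDivisorAt R s p i h ∧ ∀ x : K, IsOddDivisorAt R s p i x →
    ∃ (hx : x ∈ R i) (hh : h ∈ R i), Ideal.span {(⟨x, hx⟩ : R i)} = Ideal.span {(⟨h, hh⟩ : R i)})

/-- **d_i · HasReducedOrderAt** (D·S3's `d_i := ν_i − #odd_i`, late regime `#odd_i ≤ 1`): the member has cleaned order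
`ν` and either no odd divisor and `d = ν` (A-type) or an odd divisor and `d + 1 = ν` (B-type).  D·S3: `d_i` is
NON-INCREASING along late point steps; S1b: eventually constant `= d` odd `≥ 3`. OURS. [folklore] -/
def HasReducedOrderAt (R : ℕ → Subring K) (s : ℕ → K) (p i d : ℕ) : Prop :=
  ∃ ν : ℕ, HasCleanedOrderAt R s p i ν ∧
    ((NoOddDivisorAt R s p i ∧ d = ν) ∨ ((∃ x : K, IsOddDivisorAt R s p i x) ∧ d + 1 = ν))

/-- **A-stage**: a POINT step with NO odd divisor through the centre and ODD cleaned order `d`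
(= strat-2's `OddCleanedPointStepAt` ∧ `NoOddDivisorAt`; by S1b the second conjunct is automatic LATE — tri-2 C1). OURS. [folklore] -/
def IsAStageAt (R : ℕ → Subring K) (P : (i : ℕ) → Ideal (R i)) (s : ℕ → K) (p i d : ℕ) : Prop :=
  IsPointStep R P i ∧ NoOddDivisorAt R s p i ∧ Odd d ∧ HasCleanedOrderAt R s p i d

/-- **B-stage**: a POINT step with an odd divisor `u` through the centre (then the cleaned order is `d + 1`, even, for the
reduced order `d`). OURS. [folklore] -/
def IsBStageAt (R : ℕ → Subring K) (P : (i : ℕ) → Ideal (R i)) (s : ℕ → K) (p i : ℕ) (u : K) : Prop :=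
  IsPointStep R P i ∧ IsOddDivisorAt R s p i u

/-- **VISIT PAIR**: `j < j′` are CONSECUTIVE point steps of the run (only non-point steps — late: strips — in between). OURS. [folklore] -/
def IsVisitPair (R : ℕ → Subring K) (P : (i : ℕ) → Ideal (R i)) (j j' : ℕ) : Prop :=
  j < j' ∧ IsPointStep R P j ∧ IsPointStep R P j' ∧ ∀ k, j < k → k < j' → ¬ IsPointStep R P k

/-- **ONE-STEP LAW between visits** (the statement 096's S1a proves from `IsSteeredRun` + lateness, NOT a hypothesis word;
recorded here as the TARGET SHAPE): for a late visit pair `(j, j′)` with exceptional parameter `x` of the point step `j`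
and cleaned order `ν` at `j`: the ring is constant after the point step, and the member obeys the composite strict-transform
law with `m = ν / 2` strips-plus-step, leaving `x` ODD at `j′` iff `ν` is odd. OURS. [folklore] -/
def VisitLawAt (O : ValuationSubring K) (R : ℕ → Subring K) (P : (i : ℕ) → Ideal (R i)) (s : ℕ → K)
    (p j j' : ℕ) (x : K) (ν : ℕ) : Prop :=
  IsVisitPair R P j j' → IsExcParamAlong O (R j) (P j) x → HasCleanedOrderAt R s p j ν →
    (∀ k, j < k → k ≤ j' → R k = R (j + 1)) ∧
    (∃ G : K, G ∈ R j' ∧ s j' * x ^ (ν / 2) = s j - G) ∧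
    (Odd ν → IsOddDivisorAt R s p j' x ∧ HasClordAlongAt R s p j' x 1) ∧
    (¬ Odd ν → ¬ IsOddDivisorAt R s p j' x) ∧
    (∀ u : K, IsOddDivisorAt R s p j u →
      (IsOddDivisorAt R s p j' (u / x) ↔
        ∃ (_ : IsLocalRing (R j')) (hu : u / x ∈ R j'), (⟨u / x, hu⟩ : R j') ∈ maximalIdeal (R j')))

/-- **S1b TARGET SHAPE · EventuallyConstantReducedOrder**: from some point step on, every point step has the same reduced
order `d`, odd and `≥ 3`, and A-stages recur. OURS. [folklore] -/
def EventuallyConstantReducedOrder (R : ℕ → Subring K) (P : (i : ℕ) → Ideal (R i)) (s : ℕ → K) (p : ℕ) : Prop :=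
  ∃ d i₁ : ℕ, Odd d ∧ 3 ≤ d ∧
    (∀ i, i₁ ≤ i → IsPointStep R P i → HasReducedOrderAt R s p i d) ∧
    (∀ i₀, ∃ i, i₀ ≤ i ∧ IsAStageAt R P s p i d)

end MemberDatum

end Summit.ResolutionOfSingularities.ResolutionOfSingularities.Theorems.SwitchingDichotomy.Words
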